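import Summits.ResolutionOfSingularities.ResolutionOfSingularities.Theses.HomologicalConductor
import Summits.ResolutionOfSingularities.ResolutionOfSingularities.Theorems.HomologicalConductorNoZenoExhaustionSandwich
import Summits.ResolutionOfSingularities.ResolutionOfSingularities.Theorems.NoZeno.Negative.SurfaceKernelDimZero

/-!
# Crux `NoZeno` (stmt-ResolutionOfSingularities-16483) — surface kernel over a perfect field:
# SANDWICH OR DEFECT

Route `ResolutionOfSingularities/HomologicalConductor`, crux
`Summit.ResolutionOfSingularities.ResolutionOfSingularities.Theses.HomologicalConductor.NoZeno`,
line `birth`, skeleton v7 (`stub_surfaceLU` + `stub_sandwichedTermination`). Negative lane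
(`--supports` the crux item): structure lemmas, no Theses decl is asserted; OURS (res-L0-w44-tri-1,
BARRIER & DEFECT triage — locating where v7's local-uniformization debt actually lives).

`surfaceKernel_sandwich_or_defect`: for PERFECT `k`, under the kernel hypothesis `hker` on a surface,
EITHER the sandwich datum of `stub_sandwichedTermination` exists with no input at all (Abhyankar
habitat: `surfaceKernel_habitat_of_hker` gives defect `0`, `surfaceKernel_exhausts` gives exhaustion,
lead-1's `exh_exists_regular_le_tower_of_transcendenceDefect_eq_zero` gives `R`) OR `O` is in the
DEFECT habitat (`ratRank 1`, transcendence defect `1`). Hence for perfect `k` the named-fact debt of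
`stub_surfaceLU` (`CossartPiltant2019LU3`) is carried exactly by the defect habitat;
`surfaceKernel_defect_of_sandwichedContradiction` records the corollary (sandwiched kernels
contradictory ⇒ the surface kernel over a perfect field is a defect valuation).

Kernel-only (axioms `propext`, `Classical.choice`, `Quot.sound`); no `def`, no named fact.
-/

set_option linter.dupNamespace false

noncomputable section

namespace Summit.ResolutionOfSingularities.ResolutionOfSingularities.Theorems.NoZeno.Negative

open Summit.ResolutionOfSingularities.ResolutionOfSingularities.Theorems.NoZeno.Birth
open Literature.AlgebraicGeometry.Resolution

variable {k K : Type} [Field k] [Field K] [Algebra k K]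

/-- **SURFACE KERNEL over a PERFECT field: SANDWICH OR DEFECT** (unconditional, no `P`/`D`, no named
fact). Under the kernel hypothesis `hker` on a surface over a perfect `k`, EITHER the v7 sandwich
datum exists outright — a regular local `R ⊆ O`, `Frac R = K`, `loc O R = R`, inside every late
stage (Abhyankar habitat: defect `0`, local uniformization by Knaf–Kuhlmann for Abhyankar places,
tree `isLocallyUniformizable_of_transcendenceDefect_eq_zero`, and lead-1's cofinality p463491) —
OR `O` is in the DEFECT habitat (`ratRank O = 1`, transcendence defect `1`). So for perfect `k`
the named-fact debt of v7's `stub_surfaceLU` (`CossartPiltant2019LU3`) is carried EXACTLY by the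
defect habitat. [folklore] -/
theorem surfaceKernel_sandwich_or_defect [PerfectField k] (O : ValuationSubring K)
    (A : Subalgebra k K) (hk : ∀ c : k, algebraMap k K c ∈ O) (hA : A.FG)
    (hfr : IsFractionRing ↥A K) (hAO : A.toSubring ≤ O.toSubring)
    (hker : ∀ O' : ValuationSubring K,
      (∀ m : ℕ, ∀ s ∈ tower O A m, s ∈ O' ∧ (s⁻¹ ∈ O' → s⁻¹ ∈ O)) → ¬ IsNoetherianRing ↥O')
    (htr : Algebra.trdeg k K = 2) :
    (∃ R : Subalgebra k K, IsRegularLocalRing ↥R ∧ IsFractionRing ↥R K ∧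
      R.toSubring ≤ O.toSubring ∧ loc O R = R ∧
      ∃ m₀ : ℕ, ∀ m : ℕ, m₀ ≤ m → R ≤ tower O A m) ∨
    (ratRank O = 1 ∧ transcendenceDefect k O hk = 1) := by
  rcases (surfaceKernel_habitat_of_hker O A hk hA hfr hAO hker htr).2 with ⟨-, hD, -⟩ | h
  · exact Or.inl (exh_exists_regular_le_tower_of_transcendenceDefect_eq_zero O A hk hA hfr hAO
      (surfaceKernel_exhausts O A hk hA hfr hAO hker htr.le) hD)
  · exact Or.inr h

/-- **Corollary: over a perfect field, v7's `stub_sandwichedTermination` settles the ABHYANKAR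
habitat of the surface kernel with NO local-uniformization input.** If every sandwiched kernel
datum is contradictory (the content of `stub_sandwichedTermination`, here as the hypothesis `hST`
in its honest form "the hypotheses imply `False`", cf. `surfaceKernel_conclusion_iff_false`), then a
surface kernel over a perfect field lies in the defect habitat. [folklore] -/
theorem surfaceKernel_defect_of_sandwichedContradiction [PerfectField k] (O : ValuationSubring K)
    (A : Subalgebra k K) (hk : ∀ c : k, algebraMap k K c ∈ O) (hA : A.FG)
    (hfr : IsFractionRing ↥A K) (hAO : A.toSubring ≤ O.toSubring)
    (hker : ∀ O' : ValuationSubring K,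
      (∀ m : ℕ, ∀ s ∈ tower O A m, s ∈ O' ∧ (s⁻¹ ∈ O' → s⁻¹ ∈ O)) → ¬ IsNoetherianRing ↥O')
    (htr : Algebra.trdeg k K = 2)
    (hST : ∀ R : Subalgebra k K, IsRegularLocalRing ↥R → IsFractionRing ↥R K →
      R.toSubring ≤ O.toSubring → loc O R = R →
      ∀ m₀ : ℕ, (∀ m : ℕ, m₀ ≤ m → R ≤ tower O A m) → False) :
    ratRank O = 1 ∧ transcendenceDefect k O hk = 1 := by
  rcases surfaceKernel_sandwich_or_defect O A hk hA hfr hAO hker htr with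
    ⟨R, hreg, hRfr, hRO, hloc, m₀, hm₀⟩ | h
  · exact (hST R hreg hRfr hRO hloc m₀ hm₀).elim
  · exact h

end Summit.ResolutionOfSingularities.ResolutionOfSingularities.Theorems.NoZeno.Negative

end
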